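import Literature.MathematicalPhysics.QuantumFieldTheory.Balaban1983to89.B12Eq213Body268

/-!
# `Balaban1983to89.B12Eq213AnalyticCoupling` — T. Bałaban, *Renormalization group approach to lattice gauge field theories. I*,
Commun. Math. Phys. **109** (1987) 249–301 [Balaban1987RG1], (2.13) p. 268 with p. 263 ll. 22–28 *«C^∞ … (or analytic)»* and
p. 266 after (2.9) *«It has the advantage that the functions 𝐄^{(j)}, β_j are analytic functions of the effective coupling
constants»*: **the «(or analytic)» branch ON THE BODY — if the exponent `𝐏^{(k)} + {…}` of (2.13) extends holomorphically in the
coupling to a complex neighbourhood (with the cut-off `χ_k` coupling-free, as in the alternative cut-off of p. 266 read at fixed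
`γ_k`) under an integrable domination, then *«the integral above»* is HOLOMORPHIC in the coupling and the new term
`𝐄^{(k+1)}(g, U) = log ∫ χ_k e^{𝐏+{…}}` is REAL-ANALYTIC in `g`; kernel-checked**

statement-level skeleton of published theorems with citation tags; proofs where landed; nothing here is a claim about
the Yang–Mills mass gap

PDF held: `paper:balaban1987-cmp109-rg-i-small-field` (journal page = PDF page + 248); pp. 263, 266, 268 re-read this session from
the text layer.

CITATION HEADER / WHAT IS REPRODUCED (cell `pub-ymgap`, HUMAN RULING D-0062 Track A, seat `pub-ymgap-dag-n22-b` = the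
FIRST-MISSING-ESTIMATE seat of DAG node N22 = NE9; eighth module of the body-level chain (the analytic half of the node's printed
anchor p. 263 «C^∞ (or analytic)»; the C¹ half is `B12Eq213CouplingDependence` §2b∕§5); a NEW LEAF over r20's `B12Eq213Body268`,
nothing there modified).

THE PRINT.  p. 263 ll. 22–28: *«It is a C^∞-function of g_{j−1} ∈ [0, γ], (or analytic), with a positive, absolute γ.»*; p. 266:
*«Finally we can define the characteristic function χ_k = Π χ({|B′(b)| < ε₁}). (2.9) Another possibility is to take g_k/γ_kε₁ instead
of ε₁, where γ_k = C log(L^kε)^{−1} with C sufficiently large. It has the advantage that the functions 𝐄^{(j)}, β_j are analytic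
functions of the effective coupling constants, but it has some disadvantages in perturbative calculations also. We have formulated the
implications of both possibilities in the inductive description.»*; (2.13) p. 268.  Print gives no proof of either clause for the new
term (cell GAPS G-b12-2 (i): the g-regularity of `𝐄^{(k+1)}` is not among the properties [II] re-delivers); the tree types the clauses
as hypothesis shapes (`B12BetaSmooth.ESmoothHyp ∕ EAnalyticAt`, `T4CouplingAnalyticity.CouplingAnalyticOn`).

WHAT THIS MODULE DOES (THEOREMS ONLY; no definition, no named fact).  For the BODY `D : FluctData X` at a configuration `U` and a
complex extension `Fc : ℂ → 𝓑 → ℂ` of the exponent (`Fc ↑g B = ↑(𝐏(g,U,B) + {…}(g,U,B))` for real `g`) which, for every `B` in the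
support of `χ_U`, is holomorphic in the coupling on a complex ball around `↑g₀` with derivative `Fc′`, under an integrable domination
of `χ_U·e^{Fc}·Fc′` and integrability ∕ measurability of the integrands:
* **`hasDerivAt_cintegral`** ∕ **`differentiableOn_cintegral`** — the complexified *«integral above»* `z ↦ ∫ χ_U e^{Fc(z,·)} dμ_U` is
  complex-differentiable on the ball (dominated differentiation over `ℂ`);
* `cintegral_ofReal` — on real couplings it is `↑(∫ χ_U e^{𝐏+{…}} dμ_U)`;
* **`analyticAt_integral`** — `g ↦ ∫ χ_U e^{𝐏+{…}} dμ_U` is real-analytic at `g₀`;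
* **`analyticAt_newTerm`** — `g ↦ 𝐄^{(k+1)}(g, U)` is REAL-ANALYTIC at `g₀` (positive integral; `Real.log` analytic at positive
  points) — the «(or analytic)» clause as a theorem of the body.
HONEST READING: the holomorphic extension of Bałaban's exponent in the coupling (with the cut-off in the `g_k`-FREE variables, i.e.
the p. 266 alternative at fixed `γ_k`, or any `g`-free reading of `χ_k` — r20's `FluctData.χ` IS `g`-free) is DISPLAYED, not supplied:
for the `𝐏^{(k)}`-part it is `B12ZeroCoupling268`'s per-term analyticity; for `{…}` it is (1.17) ∘ the substitution (`B12Eq212BracketCoupling`);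
with the printed ε₁-cut-off in the scaled variable (`|B| < ε₁g_k⁻¹`) the cut-off channel of `B12Eq213CutoffDependence` is present and
this module does not apply as stated — which is exactly print's dichotomy.

WHAT IS *NOT* HERE: uniformity of the analyticity radius in `k`, `U`, the volume; localization.  HONEST FRAMING: count-neutral Track-A
side module; NOT a discharge of node N22; one finite T⁴ programme at fixed ε, Bałaban AS PRINTED with locators; nothing continuum ∕ ℝ⁴ ∕
OS ∕ mass-gap ∕ Clay.
-/

noncomputable section

namespace Literature.MathematicalPhysics.QuantumFieldTheory.Balaban1983to89.B12Eq213AnalyticCoupling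

open _root_.MeasureTheory Complex
open scoped BigOperators
open Literature.MathematicalPhysics.QuantumFieldTheory.Balaban1983to89
open Literature.MathematicalPhysics.QuantumFieldTheory.Balaban1983to89.B12Eq213Body268 (FluctData)

variable {X : Type*} (D : FluctData X)

/-- **HOLOMORPHY OF THE COMPLEXIFIED (2.13) INTEGRAL, POINTWISE**: under a holomorphic extension `Fc` of the exponent on the complex
ball `|z − z₀| < ε` (for every `B` in the support of `χ_U`), an integrable domination `‖χ_U e^{Fc} Fc′‖ ≤ bound` there, integrable
and measurable integrands, the complex integral `z ↦ ∫ χ_U(B) e^{Fc(z,B)} dμ_U(B)` has the derivative `∫ χ_U e^{Fc(z₁,·)} Fc′(z₁,·) dμ_U`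
at every `z₁` of the ball. [cite: Balaban1987RG1, (2.13) p.268 and p.266 (after (2.9))] -/
theorem hasDerivAt_cintegral {U : X} {z₀ : ℂ} {ε : ℝ} (Fc Fc' : ℂ → D.𝓑 → ℂ) (bound : D.𝓑 → ℝ)
    (hmeas : ∀ z ∈ Metric.ball z₀ ε, AEStronglyMeasurable (fun B => (D.χ U B : ℂ) * cexp (Fc z B)) (D.μ U))
    (hint : ∀ z ∈ Metric.ball z₀ ε, Integrable (fun B => (D.χ U B : ℂ) * cexp (Fc z B)) (D.μ U))
    (hmeas' : ∀ z ∈ Metric.ball z₀ ε, AEStronglyMeasurable (Fc' z) (D.μ U))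
    (hdiff : ∀ B, D.χ U B ≠ 0 → ∀ z ∈ Metric.ball z₀ ε, HasDerivAt (fun z => Fc z B) (Fc' z B) z)
    (hdom : ∀ B, D.χ U B ≠ 0 → ∀ z ∈ Metric.ball z₀ ε, ‖(D.χ U B : ℂ) * cexp (Fc z B) * Fc' z B‖ ≤ bound B)
    (hbound : Integrable bound (D.μ U)) {z₁ : ℂ} (hz₁ : z₁ ∈ Metric.ball z₀ ε) :
    HasDerivAt (fun z => ∫ B, (D.χ U B : ℂ) * cexp (Fc z B) ∂(D.μ U))
      (∫ B, (D.χ U B : ℂ) * cexp (Fc z₁ B) * Fc' z₁ B ∂(D.μ U)) z₁ := by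
  have hs : Metric.ball z₀ ε ∈ nhds z₁ := Metric.isOpen_ball.mem_nhds hz₁
  have key := hasDerivAt_integral_of_dominated_loc_of_deriv_le (μ := D.μ U)
    (F := fun z B => (D.χ U B : ℂ) * cexp (Fc z B)) (F' := fun z B => (D.χ U B : ℂ) * cexp (Fc z B) * Fc' z B)
    (x₀ := z₁) (bound := fun B => max (bound B) 0) (s := Metric.ball z₀ ε) hs ?_ (hint z₁ hz₁) ?_ ?_ hbound.pos_part ?_
  · exact key.2
  · exact Filter.eventually_of_mem hs hmeas
  · exact (hint z₁ hz₁).aestronglyMeasurable.mul (hmeas' z₁ hz₁)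
  · refine Filter.Eventually.of_forall fun B z hz => ?_
    by_cases hχ : D.χ U B = 0
    · simp [hχ]
    · exact (hdom B hχ z hz).trans (le_max_left _ _)
  · refine Filter.Eventually.of_forall fun B z hz => ?_
    by_cases hχ : D.χ U B = 0
    · have e0 : (fun z => (D.χ U B : ℂ) * cexp (Fc z B)) = fun _ => 0 := by
        funext z; simp [hχ]
      rw [e0]
      simpa [hχ] using hasDerivAt_const z (0 : ℂ)
    · have h := ((hdiff B hχ z hz).cexp).const_mul (D.χ U B : ℂ)
      simpa [mul_assoc] using h

/-- **THE COMPLEXIFIED (2.13) INTEGRAL IS HOLOMORPHIC ON THE BALL** (p. 266: *«the functions 𝐄^{(j)}, β_j are analytic functions of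
the effective coupling constants»* — the integral level, on the body). [cite: Balaban1987RG1, p.266 (after (2.9)) and (2.13) p.268] -/
theorem differentiableOn_cintegral {U : X} {z₀ : ℂ} {ε : ℝ} (Fc Fc' : ℂ → D.𝓑 → ℂ) (bound : D.𝓑 → ℝ)
    (hmeas : ∀ z ∈ Metric.ball z₀ ε, AEStronglyMeasurable (fun B => (D.χ U B : ℂ) * cexp (Fc z B)) (D.μ U))
    (hint : ∀ z ∈ Metric.ball z₀ ε, Integrable (fun B => (D.χ U B : ℂ) * cexp (Fc z B)) (D.μ U))
    (hmeas' : ∀ z ∈ Metric.ball z₀ ε, AEStronglyMeasurable (Fc' z) (D.μ U))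
    (hdiff : ∀ B, D.χ U B ≠ 0 → ∀ z ∈ Metric.ball z₀ ε, HasDerivAt (fun z => Fc z B) (Fc' z B) z)
    (hdom : ∀ B, D.χ U B ≠ 0 → ∀ z ∈ Metric.ball z₀ ε, ‖(D.χ U B : ℂ) * cexp (Fc z B) * Fc' z B‖ ≤ bound B)
    (hbound : Integrable bound (D.μ U)) :
    DifferentiableOn ℂ (fun z => ∫ B, (D.χ U B : ℂ) * cexp (Fc z B) ∂(D.μ U)) (Metric.ball z₀ ε) :=
  fun _ hz => (hasDerivAt_cintegral D Fc Fc' bound hmeas hint hmeas' hdiff hdom hbound hz).differentiableAt.differentiableWithinAt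

/-- On REAL couplings the complexified integral is the real one: if `Fc ↑g B = ↑(𝐏(g,U,B) + {…}(g,U,B))` then
`∫ χ_U e^{Fc(↑g,·)} dμ_U = ↑(∫ χ_U e^{𝐏+{…}} dμ_U)`. [cite: Balaban1987RG1, (2.13) p.268] -/
theorem cintegral_ofReal {U : X} (Fc : ℂ → D.𝓑 → ℂ) (hext : ∀ (g : ℝ) (B : D.𝓑), Fc (g : ℂ) B = ((D.exponent g U B : ℝ) : ℂ))
    (g : ℝ) : ∫ B, (D.χ U B : ℂ) * cexp (Fc (g : ℂ) B) ∂(D.μ U) = ((D.integral g U : ℝ) : ℂ) := by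
  rw [FluctData.integral, ← integral_complex_ofReal]
  refine integral_congr_ae (Filter.Eventually.of_forall fun B => ?_)
  show (D.χ U B : ℂ) * cexp (Fc (g : ℂ) B) = ((D.integrand g U B : ℝ) : ℂ)
  rw [hext g B, ← Complex.ofReal_exp, ← Complex.ofReal_mul, FluctData.integrand_apply]

/-- **THE (2.13) INTEGRAL IS REAL-ANALYTIC IN THE COUPLING** at `g₀` under a holomorphic extension of the exponent on a complex ball
around `↑g₀` (hypotheses of `differentiableOn_cintegral` at `z₀ = ↑g₀`). [cite: Balaban1987RG1, p.263 (clause before (1.18)) and p.266 (after (2.9))] -/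
theorem analyticAt_integral {U : X} {g₀ ε : ℝ} (hε : 0 < ε) (Fc Fc' : ℂ → D.𝓑 → ℂ) (bound : D.𝓑 → ℝ)
    (hext : ∀ (g : ℝ) (B : D.𝓑), Fc (g : ℂ) B = ((D.exponent g U B : ℝ) : ℂ))
    (hmeas : ∀ z ∈ Metric.ball (g₀ : ℂ) ε, AEStronglyMeasurable (fun B => (D.χ U B : ℂ) * cexp (Fc z B)) (D.μ U))
    (hint : ∀ z ∈ Metric.ball (g₀ : ℂ) ε, Integrable (fun B => (D.χ U B : ℂ) * cexp (Fc z B)) (D.μ U))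
    (hmeas' : ∀ z ∈ Metric.ball (g₀ : ℂ) ε, AEStronglyMeasurable (Fc' z) (D.μ U))
    (hdiff : ∀ B, D.χ U B ≠ 0 → ∀ z ∈ Metric.ball (g₀ : ℂ) ε, HasDerivAt (fun z => Fc z B) (Fc' z B) z)
    (hdom : ∀ B, D.χ U B ≠ 0 → ∀ z ∈ Metric.ball (g₀ : ℂ) ε, ‖(D.χ U B : ℂ) * cexp (Fc z B) * Fc' z B‖ ≤ bound B)
    (hbound : Integrable bound (D.μ U)) :
    AnalyticAt ℝ (fun g : ℝ => D.integral g U) g₀ := by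
  set I : ℂ → ℂ := fun z => ∫ B, (D.χ U B : ℂ) * cexp (Fc z B) ∂(D.μ U) with hI
  have hhol : DifferentiableOn ℂ I (Metric.ball (g₀ : ℂ) ε) :=
    differentiableOn_cintegral D Fc Fc' bound hmeas hint hmeas' hdiff hdom hbound
  have hanC : AnalyticAt ℂ I (g₀ : ℂ) :=
    hhol.analyticAt (Metric.isOpen_ball.mem_nhds (Metric.mem_ball_self hε))
  have hcomp : AnalyticAt ℝ (fun g : ℝ => I (g : ℂ)) g₀ :=
    (hanC.restrictScalars (𝕜 := ℝ)).comp (Complex.ofRealCLM.analyticAt g₀)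
  have hre : AnalyticAt ℝ (fun g : ℝ => (I (g : ℂ)).re) g₀ := (Complex.reCLM.analyticAt _).comp hcomp
  refine hre.congr (Filter.Eventually.of_forall fun g => ?_)
  show (I (g : ℂ)).re = D.integral g U
  rw [hI]
  show (∫ B, (D.χ U B : ℂ) * cexp (Fc (g : ℂ) B) ∂(D.μ U)).re = D.integral g U
  rw [cintegral_ofReal D Fc hext g, Complex.ofReal_re]

/-- **«(OR ANALYTIC)» ON THE BODY: THE NEW TERM IS REAL-ANALYTIC IN THE LAST COUPLING** at `g₀` — under a holomorphic extension of
the exponent of (2.13) on a complex ball around `↑g₀` with an integrable domination (cut-off `χ_k` coupling-free), and a positive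
integral at `g₀`, `g ↦ 𝐄^{(k+1)}(g, U) = log ∫ χ_U e^{𝐏+{…}} dμ_U` is real-analytic at `g₀` (`Real.log` analytic at positive points).
[cite: Balaban1987RG1, p.263 (clause before (1.18)), p.266 (after (2.9)) and (2.13) p.268] -/
theorem analyticAt_newTerm {U : X} {g₀ ε : ℝ} (hε : 0 < ε) (Fc Fc' : ℂ → D.𝓑 → ℂ) (bound : D.𝓑 → ℝ)
    (hext : ∀ (g : ℝ) (B : D.𝓑), Fc (g : ℂ) B = ((D.exponent g U B : ℝ) : ℂ))
    (hmeas : ∀ z ∈ Metric.ball (g₀ : ℂ) ε, AEStronglyMeasurable (fun B => (D.χ U B : ℂ) * cexp (Fc z B)) (D.μ U))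
    (hint : ∀ z ∈ Metric.ball (g₀ : ℂ) ε, Integrable (fun B => (D.χ U B : ℂ) * cexp (Fc z B)) (D.μ U))
    (hmeas' : ∀ z ∈ Metric.ball (g₀ : ℂ) ε, AEStronglyMeasurable (Fc' z) (D.μ U))
    (hdiff : ∀ B, D.χ U B ≠ 0 → ∀ z ∈ Metric.ball (g₀ : ℂ) ε, HasDerivAt (fun z => Fc z B) (Fc' z B) z)
    (hdom : ∀ B, D.χ U B ≠ 0 → ∀ z ∈ Metric.ball (g₀ : ℂ) ε, ‖(D.χ U B : ℂ) * cexp (Fc z B) * Fc' z B‖ ≤ bound B)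
    (hbound : Integrable bound (D.μ U)) (hpos : 0 < D.integral g₀ U) :
    AnalyticAt ℝ (fun g : ℝ => D.newTerm g U) g₀ := by
  have hI := analyticAt_integral D hε Fc Fc' bound hext hmeas hint hmeas' hdiff hdom hbound
  have hlog : AnalyticAt ℝ Real.log ((fun g : ℝ => D.integral g U) g₀) := analyticAt_log hpos
  have h := AnalyticAt.comp (g := Real.log) (f := fun g : ℝ => D.integral g U) (x := g₀) hlog hI
  simpa [Function.comp_def, FluctData.newTerm] using h

end Literature.MathematicalPhysics.QuantumFieldTheory.Balaban1983to89.B12Eq213AnalyticCoupling
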